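import Summits.Parity.GeneralizedHardyLittlewood.Theorems.PrimeLevelFamEdgeMomentsBeyondDiagonalLayersBlockTaylor
import HarnessLib

/-!
# Route `PrimeLevelFamEdge`, crux K_A `MomentsBeyondDiagonal` (stmt-Parity-20007), line «petersson_layers» v4:
# `stub_farP` REDUCED TO SEPARATED BILINEAR KLOOSTERMAN FORMS (assembly step E1: Bessel–Taylor truncation per block)

Fourth layer of the top-down assembly (after `…LayersBandFromLayerBound`, `…LayersLayerFromOrderBound`,
`…LayersEffectiveBox`; tools in `…LayersBlockTaylor`):
* **`subFar_rhoP_of_form_bound`**: `SubFar rhoP` (the registered signature of `stub_farP`) ⟸ on a window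
  `(1, Δ₀] ⊆ (1, 3/2]`, for every admissible `P` and `Δ'`: ONE `δ > 0`, ONE `η ∈ (0, 1/10]` and, per order `(i, j)` and
  Taylor index `k`, constants `A, q₀` with
  `Σ_{d₁,d₂ ≤ M} ‖Form_{ijk}(d₁,d₂;r)‖ ≤ A · q̂^{−δ} · (qr)^{2k+2} · r⁻¹` on the band `⌊q̂^{ρ_P}⌋ < r ≤ ⌊q̂^{ρ_W}⌋`
  (primes `q ≥ q₀`, `q̂^{Δ'} ∉ ℕ`), where (`M = ⌊q̂^{Δ'}⌋`, `Y = ⌈q̂^{2+η}⌉`, `x_m = KMV2000.mollifierCoeff P M m`)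
  `Form_{ijk}(d₁,d₂;r) = Σ_{m₁'≤M/d₁, n₁'≤q²/d₁, m₂'≤M/d₂, n₂'≤q²/d₂} [x_{d₁m₁'}x_{d₂m₂'}(√m₁'√m₂')^{2k+1}]
   · [1_{d₁n₁'d₂n₂'≤Y}(d₁n₁'d₂n₂')^{−1/2}W_{ij}(q̂;d₁n₁',d₂n₂')(√n₁'√n₂')^{2k+1}] · S(m₁'n₁', m₂'n₂'; qr)`.
  (`…LayersEffectiveBox.subFar_rhoP_of_effective_order_bound` + `K = 30` Taylor terms per block: on the band
  `2π√(M²Y)/(qr) ≤ q̂^{−1/2}`, so the truncation error of all `M²` blocks is `≪ q̂^{−31/2} ≤ q̂^{−1} r⁻¹`.)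
These forms are exactly the input shape of the unit swap / gcd extraction / regrouping / Fourier-or-Pascadi chain
(`…LayersKloostermanProduct`, `…LayersTermNormalForm`, `…LayersRegroupHyperbolic`, `…LayersBlockFourierBound`,
`…LayersBlockPascadiBound`); that bookkeeping (remaining steps E3–E7 of the census on the crux item) is NOT done here.
Proof only (def-free helper); K_A NOT proved; nothing about Landau–Siegel zeros.
-/

noncomputable section

open scoped Real Nat
open Complex Finset Polynomial MeasureTheory
open Literature.NumberTheory.LFunctions

namespace Summit.Parity.GeneralizedHardyLittlewood.Theorems.MomentsBeyondDiagonal.Layers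

open Summit.Parity.GeneralizedHardyLittlewood.Theorems.PrimeLevelFamEdgeIdeaDeltas.PeterssonLayers


/-! ## §5. `stub_farP` from bounds on the separated bilinear Kloosterman forms -/

/-- **`stub_farP`'s signature `SubFar rhoP` from PER-`(i,j,k)` BOUNDS ON THE SEPARATED BILINEAR KLOOSTERMAN FORMS,
SUMMED OVER THE HECKE DIVISORS `(d₁, d₂)`.**  If on a window `(1, Δ₀] ⊆ (1, 3/2]`, for every admissible `P` and every `Δ'` in
the window there are ONE `δ > 0` and ONE `η ∈ (0, 1/10]` such that for all `i, j, k` there are `A, q₀` with, for all primes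
`q ≥ q₀` (`q̂^{Δ'} ∉ ℕ`) and all layers `⌊q̂^{ρ_P}⌋ < r ≤ ⌊q̂^{ρ_W}⌋`,
`Σ_{d₁,d₂ ≤ M} ‖Σ_{m₁'≤M/d₁,n₁'≤q²/d₁,m₂'≤M/d₂,n₂'≤q²/d₂} [x_{d₁m₁'}x_{d₂m₂'}(√m₁'√m₂')^{2k+1}]
  [1_{d₁n₁'d₂n₂'≤Y}(d₁n₁'d₂n₂')^{−1/2}W_{ij}(q̂;d₁n₁',d₂n₂')(√n₁'√n₂')^{2k+1}] S(m₁'n₁', m₂'n₂'; qr)‖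
 ≤ A · q̂^{−δ} · (qr)^{2k+2} · r⁻¹`  (`M = ⌊q̂^{Δ'}⌋`, `Y = ⌈q̂^{2+η}⌉`),
then `SubFar rhoP` (`subFar_rhoP_of_effective_order_bound` + the `K = 30` Bessel–Taylor truncation per block:
on the band `2π√(M²Y)/(qr) ≤ q̂^{−1/2}`, so the truncation error of all blocks is `≪ q̂^{−31/2} ≤ q̂^{−1} r⁻¹`).
[folklore] -/
theorem subFar_rhoP_of_form_bound {Δ₀ : ℝ} (hΔ₀ : 1 < Δ₀) (hΔ₀' : Δ₀ ≤ 3 / 2)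
    (h : ∀ P : ℝ[X], KMV2000.Admissible P → ∀ Δ' : ℝ, 1 < Δ' → Δ' ≤ Δ₀ →
      ∃ δ η : ℝ, 0 < δ ∧ 0 < η ∧ η ≤ 1 / 10 ∧ ∀ i j k : ℕ, ∃ A : ℝ, ∃ q₀ : ℕ,
        ∀ (q : ℕ) [NeZero q], q.Prime → q₀ ≤ q → (∀ n : ℕ, (n : ℝ) ≠ KMV2000.qhat q ^ Δ') →
        ∀ (r : ℕ) [NeZero (q * r)], r ∈ Icc (layerCount q rhoP Δ' + 1) (layerCount q rhoWeil Δ') →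
          ∑ d₁ ∈ Icc 1 ⌊KMV2000.qhat q ^ Δ'⌋₊, ∑ d₂ ∈ Icc 1 ⌊KMV2000.qhat q ^ Δ'⌋₊,
            ‖∑ m₁ ∈ Icc 1 (⌊KMV2000.qhat q ^ Δ'⌋₊ / d₁), ∑ n₁ ∈ Icc 1 (q ^ 2 / d₁),
              ∑ m₂ ∈ Icc 1 (⌊KMV2000.qhat q ^ Δ'⌋₊ / d₂), ∑ n₂ ∈ Icc 1 (q ^ 2 / d₂),
                ((KMV2000.mollifierCoeff P (KMV2000.qhat q ^ Δ') (d₁ * m₁) : ℂ) *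
                    (KMV2000.mollifierCoeff P (KMV2000.qhat q ^ Δ') (d₂ * m₂) : ℂ) *
                    ((Real.sqrt m₁ ^ (2 * k + 1) * Real.sqrt m₂ ^ (2 * k + 1) : ℝ) : ℂ)) *
                  ((if d₁ * n₁ * (d₂ * n₂) ≤ ⌈KMV2000.qhat q ^ (2 + η)⌉₊ then
                      ((((((d₁ * n₁ : ℕ) : ℝ) * ((d₂ * n₂ : ℕ) : ℝ)) ^ (-(1 / 2 : ℝ)) : ℝ) : ℂ) *
                        afeW (KMV2000.qhat q) i j (d₁ * n₁) (d₂ * n₂)) else 0) *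
                    ((Real.sqrt n₁ ^ (2 * k + 1) * Real.sqrt n₂ ^ (2 * k + 1) : ℝ) : ℂ)) *
                  kloostermanSum (q * r) ((m₁ * n₁ : ℕ) : ZMod (q * r)) ((m₂ * n₂ : ℕ) : ZMod (q * r))‖ ≤
            A * KMV2000.qhat q ^ (-δ) * ((q : ℝ) * r) ^ (2 * k + 2) * ((r : ℝ))⁻¹) :
    SubFar rhoP := by
  refine subFar_rhoP_of_effective_order_bound hΔ₀ hΔ₀' fun P hP Δ' h1 h2 ↦ ?_
  obtain ⟨δ, η, hδ, hη, hη10, hijk⟩ := h P hP Δ' h1 h2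
  have h32 : Δ' ≤ 3 / 2 := h2.trans hΔ₀'
  have h0 : 0 < Δ' := by linarith
  refine ⟨min δ 1, η, lt_min hδ one_pos, hη, fun i j ↦ ?_⟩
  -- the number of Taylor terms, kept symbolic (`K = 30`)
  obtain ⟨K, hK⟩ : ∃ K : ℕ, K = 30 := ⟨30, rfl⟩
  -- constants: the form constants `A k`, thresholds `q₀ k`; `B` for `|P| ≤ B` on `[0,1]`; weight and log constants
  choose A q₀ hA using hijk i j
  set B : ℝ := ∑ i ∈ range (P.natDegree + 1), |P.coeff i| with hBdef
  have hB : ∀ t ∈ Set.Icc (0 : ℝ) 1, |P.eval t| ≤ B := fun t ht ↦ abs_eval_le_sum_abs_coeff P ht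
  have hB0 : 0 ≤ B := le_trans (abs_nonneg _) (hB 0 (by simp))
  obtain ⟨Kw, hKw0, hKw⟩ := weight_mul_sqrt_le_rpow i j (le_refl (0 : ℝ))
  obtain ⟨Cl, hCl0, hCl⟩ := logFactor_pow_le_qhat (i + j)
  have hC0 : 0 ≤ ∑ k ∈ range K, (2 * π) ^ (2 * k + 2) * |A k| := sum_nonneg fun k _ ↦ by positivity
  refine ⟨∑ k ∈ range K, (2 * π) ^ (2 * k + 2) * |A k| + 2 * π * ((4 * π ^ 2) ^ 4 * (Kw * Cl * B ^ 2)),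
    max ((range K).sup q₀) 64, fun q _ hq hq₀ hM r hr ↦ ?_⟩
  -- the scales
  have h64 : 64 ≤ q := le_trans (le_max_right _ _) hq₀
  have hq₀k : ∀ k ∈ range K, q₀ k ≤ q := fun k hk ↦
    le_trans (Finset.le_sup (f := q₀) hk) (le_trans (le_max_left _ _) hq₀)
  have hqh1 : 1 < KMV2000.qhat q := one_lt_qhat h64
  have hqh0 : 0 < KMV2000.qhat q := zero_lt_one.trans hqh1
  have hqpos : 0 < q := lt_of_lt_of_le (by norm_num) h64
  have hq0 : (0 : ℝ) < q := by exact_mod_cast hqpos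
  have hrlo : KMV2000.qhat q ^ (11 / 10 : ℝ) < r := qhat_rpow_lt_of_mem_band h64 h1 (mem_Icc.mp hr).1
  have hrhi : (r : ℝ) ≤ KMV2000.qhat q ^ (8 : ℝ) := le_qhat_rpow_eight_of_mem_band h64 h1 h32 (mem_Icc.mp hr).2
  have hrpos : (0 : ℝ) < r := lt_trans (Real.rpow_pos_of_pos hqh0 _) hrlo
  have hr0 : 0 < r := by exact_mod_cast hrpos
  haveI : NeZero (q * r) := ⟨mul_ne_zero (NeZero.ne q) hr0.ne'⟩
  have hqr0 : (0 : ℝ) < (q : ℝ) * r := by positivity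
  have hratio := taylor_ratio_le h64 h32 hη10 hrlo
  have hUV := taylor_box_le h64 h32 hη10 hrlo
  have hLx := hCl q h64
  have hq4 := natCast_eq_four_pi_sq_mul_qhat_sq q
  set x : ℝ := KMV2000.qhat q with hx
  set Mf : ℕ := ⌊x ^ Δ'⌋₊ with hMf
  set Y : ℕ := ⌈x ^ (2 + η)⌉₊ with hY
  set L : ℝ := ((1 + Real.log x) * (1 + 2 * Real.log q)) ^ (i + j) with hL
  have hL0 : 0 ≤ L := by
    rw [hL]
    refine pow_nonneg (mul_nonneg ?_ ?_) _
    · linarith [Real.log_nonneg hqh1.le]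
    · have : (1 : ℝ) ≤ q := by exact_mod_cast (le_trans (by norm_num) h64 : 1 ≤ q)
      linarith [Real.log_nonneg this]
  have hMf32 : (Mf : ℝ) ≤ x ^ (3 / 2 : ℝ) :=
    (Nat.floor_le (Real.rpow_nonneg hqh0.le _)).trans (Real.rpow_le_rpow_of_exponent_le hqh1.le h32)
  -- the Taylor remainder bound on the effective box
  set ρ₀ : ℝ := (2 * π * Real.sqrt (((Mf : ℝ)) ^ 2 * (Y : ℝ)) / ((q : ℝ) * r)) ^ (2 * K + 1) /
    ((K ! : ℝ) * ((K + 1)! : ℝ)) with hρ₀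
  have hρ₀0 : 0 ≤ ρ₀ := by rw [hρ₀]; positivity
  have hρ₀le : ρ₀ ≤ x ^ (-(61 / 2 : ℝ)) := by
    have ht0 : 0 ≤ 2 * π * Real.sqrt (((Mf : ℝ)) ^ 2 * (Y : ℝ)) / ((q : ℝ) * r) := by positivity
    have hfact : (1 : ℝ) ≤ (K ! : ℝ) * ((K + 1)! : ℝ) := by
      have h₁ : (1 : ℝ) ≤ (K ! : ℝ) := by exact_mod_cast Nat.one_le_iff_ne_zero.mpr (Nat.factorial_ne_zero K)
      have h₂ : (1 : ℝ) ≤ ((K + 1)! : ℝ) := by exact_mod_cast Nat.one_le_iff_ne_zero.mpr (Nat.factorial_ne_zero _)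
      nlinarith
    calc ρ₀ ≤ (2 * π * Real.sqrt (((Mf : ℝ)) ^ 2 * (Y : ℝ)) / ((q : ℝ) * r)) ^ (2 * K + 1) := by
          rw [hρ₀]; exact div_le_self (by positivity) hfact
      _ ≤ (x ^ (-(1 / 2 : ℝ))) ^ (2 * K + 1) := pow_le_pow_left₀ ht0 hratio _
      _ = x ^ (-(61 / 2 : ℝ)) := by
          rw [← Real.rpow_natCast, ← Real.rpow_mul hqh0.le, hK]
          norm_num
  have hbox : ∀ d₁ ∈ Icc 1 Mf, ∀ d₂ ∈ Icc 1 Mf,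
      ∀ m₁ ∈ Icc 1 (Mf / d₁), ∀ n₁ ∈ Icc 1 (q ^ 2 / d₁), ∀ m₂ ∈ Icc 1 (Mf / d₂), ∀ n₂ ∈ Icc 1 (q ^ 2 / d₂),
      (if d₁ * n₁ * (d₂ * n₂) ≤ Y then
          ((((((d₁ * n₁ : ℕ) : ℝ) * ((d₂ * n₂ : ℕ) : ℝ)) ^ (-(1 / 2 : ℝ)) : ℝ) : ℂ) *
            afeW x i j (d₁ * n₁) (d₂ * n₂)) else 0) ≠ 0 →
      2 * π ^ 2 * (((m₁ * n₁ : ℕ) : ℝ) * ((m₂ * n₂ : ℕ) : ℝ)) ≤ ((q : ℝ) * r) ^ 2 ∧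
      (2 * π * Real.sqrt (((m₁ * n₁ : ℕ) : ℝ) * ((m₂ * n₂ : ℕ) : ℝ)) / ((q : ℝ) * r)) ^ (2 * K + 1) /
        ((K ! : ℝ) * ((K + 1)! : ℝ)) ≤ ρ₀ := by
    intro d₁ hd₁ d₂ hd₂ m₁ hm₁ n₁ hn₁ m₂ hm₂ n₂ hn₂ hne
    have hcond : d₁ * n₁ * (d₂ * n₂) ≤ Y := by
      by_contra hc
      exact hne (if_neg hc)
    have hd₁1 : 1 ≤ d₁ := (mem_Icc.mp hd₁).1
    have hd₂1 : 1 ≤ d₂ := (mem_Icc.mp hd₂).1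
    have hm : ((m₁ * m₂ : ℕ) : ℝ) ≤ ((Mf : ℝ)) ^ 2 := by
      have h₁ : m₁ ≤ Mf := (mem_Icc.mp hm₁).2.trans (Nat.div_le_self _ _)
      have h₂ : m₂ ≤ Mf := (mem_Icc.mp hm₂).2.trans (Nat.div_le_self _ _)
      have : m₁ * m₂ ≤ Mf * Mf := Nat.mul_le_mul h₁ h₂
      rw [sq]; exact_mod_cast this
    have hn : ((n₁ * n₂ : ℕ) : ℝ) ≤ (Y : ℝ) := by
      have : n₁ * n₂ ≤ d₁ * n₁ * (d₂ * n₂) :=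
        Nat.mul_le_mul (Nat.le_mul_of_pos_left n₁ hd₁1) (Nat.le_mul_of_pos_left n₂ hd₂1)
      exact_mod_cast this.trans hcond
    exact box_hypothesis_of_le hqpos hr0 hm hn hUV K
  -- STEP 1: the effective order sum is the sum of its `(d₁, d₂)` blocks (filter ↦ indicator weight)
  have hsplit :
      ∑ d₁ ∈ Icc 1 Mf, ∑ d₂ ∈ Icc 1 Mf, ∑ m₁ ∈ Icc 1 (Mf / d₁), ∑ n₁ ∈ Icc 1 (q ^ 2 / d₁),
        ∑ m₂ ∈ Icc 1 (Mf / d₂), ∑ n₂ ∈ (Icc 1 (q ^ 2 / d₂)).filter (fun n₂ ↦ d₁ * n₁ * (d₂ * n₂) ≤ Y),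
          ((((((d₁ * n₁ : ℕ) : ℝ) * ((d₂ * n₂ : ℕ) : ℝ)) ^ (-(1 / 2 : ℝ)) : ℝ) : ℂ) * afeW x i j (d₁ * n₁) (d₂ * n₂)) *
            ((KMV2000.mollifierCoeff P (x ^ Δ') (d₁ * m₁) : ℂ) * (KMV2000.mollifierCoeff P (x ^ Δ') (d₂ * m₂) : ℂ) *
              layerKernel q r (m₁ * n₁) (m₂ * n₂)) =
      ∑ d₁ ∈ Icc 1 Mf, ∑ d₂ ∈ Icc 1 Mf, ∑ m₁ ∈ Icc 1 (Mf / d₁), ∑ n₁ ∈ Icc 1 (q ^ 2 / d₁),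
        ∑ m₂ ∈ Icc 1 (Mf / d₂), ∑ n₂ ∈ Icc 1 (q ^ 2 / d₂),
          (if d₁ * n₁ * (d₂ * n₂) ≤ Y then
              ((((((d₁ * n₁ : ℕ) : ℝ) * ((d₂ * n₂ : ℕ) : ℝ)) ^ (-(1 / 2 : ℝ)) : ℝ) : ℂ) *
                afeW x i j (d₁ * n₁) (d₂ * n₂)) else 0) *
            ((KMV2000.mollifierCoeff P (x ^ Δ') (d₁ * m₁) : ℂ) * (KMV2000.mollifierCoeff P (x ^ Δ') (d₂ * m₂) : ℂ) *
              layerKernel q r (m₁ * n₁) (m₂ * n₂)) := by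
    refine sum_congr rfl fun d₁ _ ↦ sum_congr rfl fun d₂ _ ↦ sum_congr rfl fun m₁ _ ↦ sum_congr rfl fun n₁ _ ↦
      sum_congr rfl fun m₂ _ ↦ ?_
    rw [sum_filter]
    refine sum_congr rfl fun n₂ _ ↦ ?_
    split_ifs <;> simp
  rw [hsplit]
  -- STEP 2: per block, forms + truncation error, the latter with the crude weight sum
  have hblk : ∀ d₁ ∈ Icc 1 Mf, ∀ d₂ ∈ Icc 1 Mf,
      ‖∑ m₁ ∈ Icc 1 (Mf / d₁), ∑ n₁ ∈ Icc 1 (q ^ 2 / d₁), ∑ m₂ ∈ Icc 1 (Mf / d₂), ∑ n₂ ∈ Icc 1 (q ^ 2 / d₂),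
          (if d₁ * n₁ * (d₂ * n₂) ≤ Y then
              ((((((d₁ * n₁ : ℕ) : ℝ) * ((d₂ * n₂ : ℕ) : ℝ)) ^ (-(1 / 2 : ℝ)) : ℝ) : ℂ) *
                afeW x i j (d₁ * n₁) (d₂ * n₂)) else 0) *
            ((KMV2000.mollifierCoeff P (x ^ Δ') (d₁ * m₁) : ℂ) * (KMV2000.mollifierCoeff P (x ^ Δ') (d₂ * m₂) : ℂ) *
              layerKernel q r (m₁ * n₁) (m₂ * n₂))‖ ≤
        ∑ k ∈ range K, (2 * π) ^ (2 * k + 2) / ((q : ℝ) * r) ^ (2 * k + 2) *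
          ‖∑ m₁ ∈ Icc 1 (Mf / d₁), ∑ n₁ ∈ Icc 1 (q ^ 2 / d₁), ∑ m₂ ∈ Icc 1 (Mf / d₂), ∑ n₂ ∈ Icc 1 (q ^ 2 / d₂),
            ((KMV2000.mollifierCoeff P (x ^ Δ') (d₁ * m₁) : ℂ) * (KMV2000.mollifierCoeff P (x ^ Δ') (d₂ * m₂) : ℂ) *
                ((Real.sqrt m₁ ^ (2 * k + 1) * Real.sqrt m₂ ^ (2 * k + 1) : ℝ) : ℂ)) *
              ((if d₁ * n₁ * (d₂ * n₂) ≤ Y then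
                  ((((((d₁ * n₁ : ℕ) : ℝ) * ((d₂ * n₂ : ℕ) : ℝ)) ^ (-(1 / 2 : ℝ)) : ℝ) : ℂ) *
                    afeW x i j (d₁ * n₁) (d₂ * n₂)) else 0) *
                ((Real.sqrt n₁ ^ (2 * k + 1) * Real.sqrt n₂ ^ (2 * k + 1) : ℝ) : ℂ)) *
              kloostermanSum (q * r) ((m₁ * n₁ : ℕ) : ZMod (q * r)) ((m₂ * n₂ : ℕ) : ZMod (q * r))‖ +
        2 * π * ρ₀ * (((Mf : ℝ) * (q : ℝ) ^ 2) ^ 2 * (Kw * L * B ^ 2)) := by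
    intro d₁ hd₁ d₂ hd₂
    have hmain := norm_block_le_sum_forms_add q hr0 (Icc 1 (Mf / d₁)) (Icc 1 (q ^ 2 / d₁)) (Icc 1 (Mf / d₂))
      (Icc 1 (q ^ 2 / d₂))
      (fun n₁ n₂ ↦ if d₁ * n₁ * (d₂ * n₂) ≤ Y then
          ((((((d₁ * n₁ : ℕ) : ℝ) * ((d₂ * n₂ : ℕ) : ℝ)) ^ (-(1 / 2 : ℝ)) : ℝ) : ℂ) *
            afeW x i j (d₁ * n₁) (d₂ * n₂)) else 0)
      (fun m ↦ (KMV2000.mollifierCoeff P (x ^ Δ') (d₁ * m) : ℂ))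
      (fun m ↦ (KMV2000.mollifierCoeff P (x ^ Δ') (d₂ * m) : ℂ)) K (hbox d₁ hd₁ d₂ hd₂)
    have hw := sum_block_weights_le h64 hB h0 i j hKw0 (fun hN₁ hN₂ ↦ hKw h64 hN₁ hN₂) Y hd₁ hd₂
    refine hmain.trans (add_le_add le_rfl ?_)
    exact mul_le_mul_of_nonneg_left hw (by positivity)
  -- STEP 3: sum over the blocks and split into forms + errors
  refine (norm_sum_le _ _).trans ((sum_le_sum fun d₁ hd₁ ↦ (norm_sum_le _ _).trans
    (sum_le_sum fun d₂ hd₂ ↦ hblk d₁ hd₁ d₂ hd₂)).trans ?_)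
  simp only [sum_add_distrib]
  -- the forms: swap the `k`-sum outside and use the hypothesis
  have hswap : ∀ (f : ℕ → ℕ → ℕ → ℝ) (c : ℕ → ℝ),
      ∑ d₁ ∈ Icc 1 Mf, ∑ d₂ ∈ Icc 1 Mf, ∑ k ∈ range K, c k * f k d₁ d₂ =
        ∑ k ∈ range K, c k * ∑ d₁ ∈ Icc 1 Mf, ∑ d₂ ∈ Icc 1 Mf, f k d₁ d₂ := by
    intro f c
    have h1 : ∀ d₁ : ℕ, ∑ d₂ ∈ Icc 1 Mf, ∑ k ∈ range K, c k * f k d₁ d₂ =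
        ∑ k ∈ range K, ∑ d₂ ∈ Icc 1 Mf, c k * f k d₁ d₂ := fun d₁ ↦ sum_comm
    simp_rw [h1]
    rw [sum_comm]
    simp_rw [mul_sum]
  have hforms :
      ∑ d₁ ∈ Icc 1 Mf, ∑ d₂ ∈ Icc 1 Mf, ∑ k ∈ range K, (2 * π) ^ (2 * k + 2) / ((q : ℝ) * r) ^ (2 * k + 2) *
          ‖∑ m₁ ∈ Icc 1 (Mf / d₁), ∑ n₁ ∈ Icc 1 (q ^ 2 / d₁), ∑ m₂ ∈ Icc 1 (Mf / d₂), ∑ n₂ ∈ Icc 1 (q ^ 2 / d₂),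
            ((KMV2000.mollifierCoeff P (x ^ Δ') (d₁ * m₁) : ℂ) * (KMV2000.mollifierCoeff P (x ^ Δ') (d₂ * m₂) : ℂ) *
                ((Real.sqrt m₁ ^ (2 * k + 1) * Real.sqrt m₂ ^ (2 * k + 1) : ℝ) : ℂ)) *
              ((if d₁ * n₁ * (d₂ * n₂) ≤ Y then
                  ((((((d₁ * n₁ : ℕ) : ℝ) * ((d₂ * n₂ : ℕ) : ℝ)) ^ (-(1 / 2 : ℝ)) : ℝ) : ℂ) *
                    afeW x i j (d₁ * n₁) (d₂ * n₂)) else 0) *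
                ((Real.sqrt n₁ ^ (2 * k + 1) * Real.sqrt n₂ ^ (2 * k + 1) : ℝ) : ℂ)) *
              kloostermanSum (q * r) ((m₁ * n₁ : ℕ) : ZMod (q * r)) ((m₂ * n₂ : ℕ) : ZMod (q * r))‖ ≤
        (∑ k ∈ range K, (2 * π) ^ (2 * k + 2) * |A k|) * x ^ (-δ) * ((r : ℝ))⁻¹ := by
    refine (hswap _ _).trans_le ?_
    rw [sum_mul, sum_mul]
    refine sum_le_sum fun k hk ↦ ?_
    have hAk := hA k q hq (hq₀k k hk) hM r hr
    refine (mul_le_mul_of_nonneg_left hAk (by positivity)).trans ?_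
    calc _ = (2 * π) ^ (2 * k + 2) * A k * (x ^ (-δ) * ((r : ℝ))⁻¹) := by field_simp; ring
      _ ≤ (2 * π) ^ (2 * k + 2) * |A k| * (x ^ (-δ) * ((r : ℝ))⁻¹) :=
          mul_le_mul_of_nonneg_right (mul_le_mul_of_nonneg_left (le_abs_self _) (by positivity)) (by positivity)
      _ = _ := by ring
  -- the truncation errors: `Mf² · 2πρ₀ (Mf q²)² Kw L B² ≤ C x^{-31/2} ≤ C x^{-1} r⁻¹`
  have hfin : x ^ (-(31 / 2 : ℝ)) ≤ x ^ (-min δ 1) * ((r : ℝ))⁻¹ := by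
    have h₁ : x ^ (-(31 / 2 : ℝ)) ≤ x ^ (-(1 : ℝ)) * x ^ (-(8 : ℝ)) := by
      rw [← Real.rpow_add hqh0]
      exact Real.rpow_le_rpow_of_exponent_le hqh1.le (by norm_num)
    have h₂ : x ^ (-(1 : ℝ)) ≤ x ^ (-min δ 1) :=
      Real.rpow_le_rpow_of_exponent_le hqh1.le (by linarith [min_le_right δ 1])
    have h₃ : x ^ (-(8 : ℝ)) ≤ ((r : ℝ))⁻¹ := by
      rw [Real.rpow_neg hqh0.le]
      exact inv_anti₀ hrpos hrhi
    exact h₁.trans (mul_le_mul h₂ h₃ (by positivity) (by positivity))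
  have herr : ∑ _d₁ ∈ Icc 1 Mf, ∑ _d₂ ∈ Icc 1 Mf, 2 * π * ρ₀ * (((Mf : ℝ) * (q : ℝ) ^ 2) ^ 2 * (Kw * L * B ^ 2)) ≤
      2 * π * ((4 * π ^ 2) ^ 4 * (Kw * Cl * B ^ 2)) * x ^ (-min δ 1) * ((r : ℝ))⁻¹ := by
    simp only [sum_const, nsmul_eq_mul, Nat.card_Icc, Nat.add_sub_cancel]
    have step1 : (Mf : ℝ) * ((Mf : ℝ) * (2 * π * ρ₀ * (((Mf : ℝ) * (q : ℝ) ^ 2) ^ 2 * (Kw * L * B ^ 2)))) =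
        2 * π * (Kw * B ^ 2) * (ρ₀ * ((Mf : ℝ) ^ 4 * ((q : ℝ) ^ 4 * L))) := by ring
    rw [step1]
    have hM4 : (Mf : ℝ) ^ 4 ≤ x ^ (6 : ℝ) := by
      calc (Mf : ℝ) ^ 4 ≤ (x ^ (3 / 2 : ℝ)) ^ 4 := pow_le_pow_left₀ (Nat.cast_nonneg _) hMf32 4
        _ = x ^ (6 : ℝ) := by rw [← Real.rpow_natCast, ← Real.rpow_mul hqh0.le]; norm_num
    have hq8 : (q : ℝ) ^ 4 = (4 * π ^ 2) ^ 4 * x ^ (8 : ℝ) := by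
      rw [hq4, mul_pow, show (8 : ℝ) = 2 * ((4 : ℕ) : ℝ) by norm_num, Real.rpow_mul hqh0.le, Real.rpow_natCast,
        Real.rpow_two]
    have hinner : ρ₀ * ((Mf : ℝ) ^ 4 * ((q : ℝ) ^ 4 * L)) ≤
        x ^ (-(61 / 2 : ℝ)) * (x ^ (6 : ℝ) * ((4 * π ^ 2) ^ 4 * x ^ (8 : ℝ) * (Cl * x))) :=
      mul_le_mul hρ₀le (mul_le_mul hM4 (mul_le_mul hq8.le hLx hL0 (by positivity)) (by positivity)
        (by positivity)) (by positivity) (by positivity)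
    have hexp : x ^ (-(61 / 2 : ℝ)) * (x ^ (6 : ℝ) * ((4 * π ^ 2) ^ 4 * x ^ (8 : ℝ) * (Cl * x))) =
        (4 * π ^ 2) ^ 4 * Cl * x ^ (-(31 / 2 : ℝ)) := by
      calc _ = (4 * π ^ 2) ^ 4 * Cl * (x ^ (-(61 / 2 : ℝ)) * x ^ (6 : ℝ) * x ^ (8 : ℝ) * x ^ (1 : ℝ)) := by
            rw [Real.rpow_one]; ring
        _ = (4 * π ^ 2) ^ 4 * Cl * x ^ (-(31 / 2 : ℝ)) := by
            rw [← Real.rpow_add hqh0, ← Real.rpow_add hqh0, ← Real.rpow_add hqh0]; norm_num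
    calc 2 * π * (Kw * B ^ 2) * (ρ₀ * ((Mf : ℝ) ^ 4 * ((q : ℝ) ^ 4 * L)))
        ≤ 2 * π * (Kw * B ^ 2) * ((4 * π ^ 2) ^ 4 * Cl * x ^ (-(31 / 2 : ℝ))) := by
          rw [← hexp]; exact mul_le_mul_of_nonneg_left hinner (by positivity)
      _ ≤ 2 * π * (Kw * B ^ 2) * ((4 * π ^ 2) ^ 4 * Cl * (x ^ (-min δ 1) * ((r : ℝ))⁻¹)) :=
          mul_le_mul_of_nonneg_left (mul_le_mul_of_nonneg_left hfin (by positivity)) (by positivity)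
      _ = _ := by ring
  -- combine
  have hδmono : x ^ (-δ) ≤ x ^ (-min δ 1) :=
    Real.rpow_le_rpow_of_exponent_le hqh1.le (by linarith [min_le_left δ 1])
  refine (add_le_add hforms herr).trans ?_
  calc (∑ k ∈ range K, (2 * π) ^ (2 * k + 2) * |A k|) * x ^ (-δ) * ((r : ℝ))⁻¹ +
        2 * π * ((4 * π ^ 2) ^ 4 * (Kw * Cl * B ^ 2)) * x ^ (-min δ 1) * ((r : ℝ))⁻¹
      ≤ (∑ k ∈ range K, (2 * π) ^ (2 * k + 2) * |A k|) * x ^ (-min δ 1) * ((r : ℝ))⁻¹ +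
        2 * π * ((4 * π ^ 2) ^ 4 * (Kw * Cl * B ^ 2)) * x ^ (-min δ 1) * ((r : ℝ))⁻¹ :=
        add_le_add (mul_le_mul_of_nonneg_right (mul_le_mul_of_nonneg_left hδmono hC0) (by positivity)) le_rfl
    _ = _ := by ring

end Summit.Parity.GeneralizedHardyLittlewood.Theorems.MomentsBeyondDiagonal.Layers

end
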